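import Literature.NumberTheory.QuadraticForms.HilbertSymbolQuaternion
import Literature.NumberTheory.GaloisRepresentations.HeckeCharacter
import HarnessLib

/-!
# Norm groups of quadratic extensions: the local norm subgroup, norm idèles, and the
# global and local norm index theorems (O'Meara 65:21, 63:13)

Topic `NumberTheory/QuadraticForms`; namespace `Literature`. This file vendors the two inputs — besides
Hilbert's reciprocity law `hilbertReciprocity` (O'Meara 71:18, `HilbertSymbol.lean`) — of
O'Meara's proof (§71) of Thm. 71:19, the existence of field elements
with prescribed local Hilbert symbols (the named fact `exists_hilbertSymbol_eq_neg_one_iff` of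
`HilbertSymbolPrescribed.lean`, itself the class-field-theoretic input of the classification of
quaternion algebras over a number field, Vignéras III Thm. 3.1). The deduction of 71:19 from
them is carried out in `HilbertSymbolPrescribedProofs.lean`.

Definitions (honest, with bodies):

* `quadraticNormSubgroup F a : Subgroup Fˣ` — the non-zero values of the binary form
  `X² - a Y²` over a field `F`, i.e. the norms `N(x + y√a) = x² - a y²` of units of the quadratic
  algebra `F[√a] = F[X]/(X² - a)`; a subgroup by Brahmagupta's identity. For `a` a non-square
  this is the norm group `N_{E/F} Eˣ` of `E = F(√a)`; for `a` a non-zero square (and `2 ≠ 0`)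
  it is all of `Fˣ` (`quadraticNormSubgroup_eq_top_of_isSquare`). Link with the Hilbert symbol
  of `HilbertSymbol.lean`: `(t, a)_F = 1 ↔ t ∈ quadraticNormSubgroup F a`
  (`hilbertSymbol_eq_one_iff_mem_quadraticNormSubgroup`, O'Meara §65A: "`α` is a local norm at `𝔭`
  iff `(α, θ)_𝔭 = 1`").
* `ideleFiniteComponent K v : 𝕀_K →* K_vˣ` (`Units.map` of the tree's projection
  `Literature.NumberTheory.Automorphic.AdelicGroupData.adeleEval K v : 𝔸_K →+* K_v`; definitionally the `toLocal v` of
  the adelic group datum `AdelicGroupData.gl1 K`), `adeleInfiniteComponent K w : 𝔸_K →+* K_w`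
  (the archimedean twin of `adeleEval`, not in the tree) and
  `ideleInfiniteComponent K w : 𝕀_K →* K_wˣ` — the components of an idèle
  (`𝕀_K = Literature.NumberTheory.GaloisRepresentations.ideleGroup K = (𝔸_K)ˣ`, `HeckeCharacter.lean`).
* `normIdeles K a : Subgroup (ideleGroup K)` — the idèles of `K` that are local norms from
  `K_v(√a)` at every finite place `v` and from `K_w(√a)` at every infinite place `w`. For `a` a
  non-square in `K` and `E = K(√a)` this is the group `N_{E/K} J_E` of norms of idèles of `E`
  (O'Meara §65A, Example 65:2: an idèle of `K` is in `N_{E/K} J_E` iff it is a local norm at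
  every place), written without reference to the idèles of `E`. (Mathlib has no norm map between
  adèle rings of different fields; the tree has the Galois-theoretic idelic norm
  `Literature.NumberTheory.Automorphic.AdeleRing.ideleGalNorm F E` and the subgroups
  `Literature.NumberTheory.Automorphic.idelicNormSubgroup F E = N(𝔸_Eˣ) ∩ 𝔸_Fˣ`,
  `Literature.NumberTheory.Automorphic.normGroup F E = principalIdeles F ⊔ idelicNormSubgroup F E` of
  `Literature/NumberTheory/Automorphic/ClassFieldCharacter.lean`; the identification
  `normIdeles K a = idelicNormSubgroup K K(√a)`, i.e. Example 65:2 itself, is *not* proved in this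
  file, and `normIdeles_index_eq_two` below is the index of `normGroup K K(√a)` only modulo that
  identification. Downstream the identification IS a theorem of the tree — see "Status" below:
  `Literature.NumberTheory.Automorphic.idelicNormSubgroup_eq_normIdeles` and
  `Literature.NumberTheory.Automorphic.range_ideleRelNorm_eq_normIdeles`
  (`Automorphic/QuadraticIdelicNormRange.lean`), for the idelic norm
  `Literature.NumberTheory.Automorphic.AdeleRing.ideleRelNorm F E : 𝕀_E →* 𝕀_F` of
  `Automorphic/AdeleGaloisDescent.lean`.)

Named facts (published theorems not provable at the Mathlib pin, `def … : Prop` with citation):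

* `normIdeles_index_eq_two K` : **O'Meara 65:21** — for a quadratic extension `E/K` of global
  fields, `(J_K : P_K N_{E/K} J_E) = 2`; here for a number field `K` and `E = K(√a)`, `a` a
  non-square: the subgroup `principalIdeles K ⊔ normIdeles K a` of `𝕀_K` has index `2`. This is
  the norm index theorem of class field theory for quadratic extensions (Vignéras, LNM 800,
  III Thm. 3.7: `[K_A^× : K^× n(L_A^×)] = 2`); O'Meara's proof (§65B–D) uses the `S`-unit theorem
  and the finiteness of the class number (index computations 65:8–65:14, giving the inequality
  `≥ 2` and the Global Square Theorem 65:15), the local norm index 63:13a, and the independence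
  of `S`-units modulo squares at suitable places (65:17–65:18); none of this is available for
  number fields and their completions in Mathlib at the pin.
* `normIdeles_index_dvd_two K` : the **second inequality** `(J_K : P_K N_{E/K} J_E) ∣ 2` for
  `E = K(√a)` — what O'Meara's proof of 65:21 actually establishes (its step 1 reduces 65:21 to
  `≤ 2`, the inequality `≥ 2` being 65:14); the weaker input that suffices, together with
  reciprocity, for 71:19 (`HilbertSymbolPrescribedProofs.lean`).
* `two_le_normIdeles_index K` : the **first inequality** (O'Meara 65:14,
  `2 ≤ (J_K : P_K N_{E/K} J_E) < ∞`); its consequence `J_K ≠ P_K N_{E/K} J_E`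
  (`ne_top_of_two_le_normIdeles_index`) is what the proofs of 65:15 and 65:18a use, and with the
  second inequality it gives 65:21 back (`normIdeles_index_eq_two_of_dvd_two_of_two_le`).
* `adicCompletion_exists_hilbertSymbol_eq_neg_one K` : **O'Meara 63:13** — over a local field
  `F`, for every non-square `β ∈ Fˣ` there is `α ∈ Fˣ` with `(α, β)_F = -1`; here for the
  completions `F = K_v` of the number field `K` at its finite places `v` (the real case,
  `α = -1`, is elementary and the complex case is vacuous). O'Meara's proof is a dyadic analysis
  of the quadratic defect (§63A); the non-dyadic case only needs the parity of valuations and a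
  non-square residue.

## Mathlib / tree search

Mathlib (pin `v4.32.0`): adèles `NumberField.AdeleRing (𝓞 K) K = K_∞ × 𝔸_K^f`, idèles as units,
`Subgroup.index`, `IsSquare`; no norm groups, no norm index theorems, no local class field theory
(`rg -i "norm index" Mathlib`, `rg normSubgroup`: nothing relevant). Tree: `Literature.NumberTheory.GaloisRepresentations.ideleGroup`,
`Literature.NumberTheory.GaloisRepresentations.principalIdeles`, `Literature.NumberTheory.GaloisRepresentations.localUnits` (`HeckeCharacter.lean`),
`Literature.NumberTheory.Automorphic.AdelicGroupData.adeleEval` / `finiteAdeleEval` (`AdelicGroupData.lean`, the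
finite-place projections, reused here), `Literature.NumberTheory.QuadraticForms.hilbertSymbol`, `Literature.NumberTheory.QuadraticForms.hilbertReciprocity`
(`HilbertSymbol.lean`), `Literature.NumberTheory.QuadraticForms.exists_sq_sub_mul_sq_iff_hilbertSymbol_eq_one`
(`HilbertSymbolQuaternion.lean`); the abstract local norm groups `Literature.NumberTheory.GaloisRepresentations.IsNormSubgroup` /
`index_normSubgroup_eq_finrank` of `GaloisRepresentations/LocalExistenceTheorem.lean` are the
`N_{E/F}(Eˣ)` of local class field theory (linked to `quadraticNormSubgroup` in
`QuadraticNormLocalCFT.lean`); the global twins `Literature.NumberTheory.Automorphic.idelicNormSubgroup F E`,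
`Literature.NumberTheory.Automorphic.normGroup F E` (`Automorphic/ClassFieldCharacter.lean`, via the Galois norm on
`𝔸_Eˣ`) describe `N_{E/F} J_E` and `F^× N_{E/F} J_E` through the idèles of `E`; their comparison
with `normIdeles` (O'Meara Example 65:2) was not in the tree when this file was written, nor any
index statement about `normGroup` (lean search at the time) — both exist now, downstream of this
file: see "Status".

## Status (pointers only; nothing below is imported here — these files import this one)

* Every named fact of this file is discharged in the tree:
  `OMeara65.two_le_normIdeles_index_holds` and `OMeara65.normIdeles_index_eq_two_holds`
  (`QuadraticForms/HasseNormTheoremHolds.lean`), `OMeara65.normIdeles_index_dvd_two_holds`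
  (`QuadraticForms/SUnitSquareClassesProofs.lean`),
  `adicCompletion_exists_hilbertSymbol_eq_neg_one_holds` (`QuadraticForms/LocalNormIndex.lean`);
  the discharged facts stay `def`s — users' hypotheses `(h : normIdeles_index_eq_two K)` etc. are
  fed the `_holds`.
* **Example 65:2 itself** (`N_{E/K} J_E = normIdeles K a` for `E = K(√a)`, at the level of idèles,
  both inclusions) is the theorem `Literature.NumberTheory.Automorphic.range_ideleRelNorm_eq_normIdeles`
  of `Automorphic/QuadraticIdelicNormRange.lean` (with `mem_range_ideleRelNorm_iff`, the sentence as
  printed: "`𝔦` is in `N_{E/F} J_E` if and only if it is a local norm at all `𝔭`", and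
  `idelicNormSubgroup_eq_normIdeles : idelicNormSubgroup F E = normIdeles F d`); the inclusion `⊆`
  alone, from the coordinates `N_{E/F}((a ⊗ 1) + (b ⊗ 1) δ) = a² - d b²` of the idelic norm
  (`coe_ideleRelNorm_eq_sq_sub_mul_sq`), is `range_ideleRelNorm_le_normIdeles` of
  `Automorphic/QuadraticIdelicNormLocalNorms.lean`, which also proves Example 65:2 modulo `Fˣ`,
  `normGroup_eq_principalIdeles_sup_normIdeles : normGroup F E = principalIdeles F ⊔ normIdeles F d`,
  and the Hasse norm theorem 65:23 in idelic form is `principalIdeles_inf_range_ideleRelNorm_eq`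
  (`QuadraticIdelicNormRange`).
* Index statements about `normGroup`: `Literature.NumberTheory.Automorphic.index_normGroup_eq_finrank_of_isCyclic`
  (`(𝕀_F : Fˣ N_{E/F} 𝕀_E) = [E : F]` for `E/F` cyclic, `Automorphic/ExistsClassFieldCharacterHolds.lean`)
  and, in the vocabulary of this file, `Literature.NumberTheory.Automorphic.index_principalIdeles_sup_normIdeles`
  (`Automorphic/QuadraticHeckeCharacter.lean`, = `normIdeles_index_eq_two_holds`).

## References

* O. T. O'Meara, *Introduction to quadratic forms*, Grundlehren 117, Springer (1963): §63B
  (Hilbert symbol; Prop. 63:13, Cor. 63:13a), §65A (local norms and `N_{E/F} J_E`,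
  Example 65:2), §65D (Prop. 65:21), §71 (Thm. 71:18, Thm. 71:19, Cor. 71:19a and its proof).
* M.-F. Vignéras, *Arithmétique des algèbres de quaternions*, LNM 800 (1980), Ch. III §3,
  Thm. 3.7 and the proof of Thm. 3.8.
-/

noncomputable section

open NumberField IsDedekindDomain

namespace Literature.NumberTheory.QuadraticForms

/-! ### Norms from the quadratic algebra `F[√a]` -/

section Local

variable (F : Type*) [Field F]

/-- The **norm subgroup** of the quadratic algebra `F[√a]`: the units `t ∈ Fˣ` of the form
`t = x² - a y²` (`x y ∈ F`), i.e. the non-zero norms `N(x + y√a)`. It is a subgroup of `Fˣ`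
(Brahmagupta's identity `(x² - a y²)(z² - a w²) = (xz + ayw)² - a(xw + yz)²`, and
`t⁻¹ = (x/t)² - a (y/t)²`). For `a` a non-square, `F[√a] = E` is a quadratic field extension and
this is `N_{E/F} Eˣ` (O'Meara §65A, "local norm"); for `a = c² ≠ 0` (and `2 ≠ 0` in `F`) it
is all of `Fˣ` (`quadraticNormSubgroup_eq_top_of_isSquare`; in characteristic `2`,
`x² - c² y² = (x - c y)²` and the subgroup is the group of non-zero squares). [folklore] -/
def quadraticNormSubgroup (a : F) : Subgroup Fˣ where
  carrier := {t | ∃ x y : F, x ^ 2 - a * y ^ 2 = t}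
  mul_mem' := by
    rintro s t ⟨x, y, hs⟩ ⟨z, w, ht⟩
    refine ⟨x * z + a * y * w, x * w + y * z, ?_⟩
    rw [Units.val_mul, ← hs, ← ht]
    ring
  one_mem' := ⟨1, 0, by simp⟩
  inv_mem' := by
    rintro t ⟨x, y, ht⟩
    have ht0 : (t : F) ≠ 0 := t.ne_zero
    refine ⟨x / t, y / t, ?_⟩
    rw [Units.val_inv_eq_inv_val, div_pow, div_pow, ← ht]
    field_simp

variable {F}

/-- Membership in `quadraticNormSubgroup F a` (definitional). [folklore] -/
theorem mem_quadraticNormSubgroup_iff {a : F} {t : Fˣ} :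
    t ∈ quadraticNormSubgroup F a ↔ ∃ x y : F, x ^ 2 - a * y ^ 2 = t := Iff.rfl

/-- Squares are norms: if `t = r²` then `t = r² - a·0²`. [folklore] -/
theorem mem_quadraticNormSubgroup_of_isSquare (a : F) {t : Fˣ} (ht : IsSquare (t : F)) :
    t ∈ quadraticNormSubgroup F a := by
  obtain ⟨r, hr⟩ := ht
  exact ⟨r, 0, by rw [hr]; ring⟩

/-- The unit `t * t` is a norm. [folklore] -/
theorem mul_self_mem_quadraticNormSubgroup (a : F) (t : Fˣ) :
    t * t ∈ quadraticNormSubgroup F a :=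
  mem_quadraticNormSubgroup_of_isSquare a ⟨t, by rw [Units.val_mul]⟩

/-- If `a = c²` is a non-zero square (and `2 ≠ 0` in `F`) every unit is a norm:
`t = x² - c² y²` with `x = (1 + t)/2`, `y = (t - 1)/(2c)` (`F[√a] ≅ F × F`). [folklore] -/
theorem quadraticNormSubgroup_eq_top_of_isSquare [NeZero (2 : F)] {a : F} (ha : IsSquare a)
    (ha0 : a ≠ 0) : quadraticNormSubgroup F a = ⊤ := by
  obtain ⟨c, rfl⟩ := ha
  have hc : c ≠ 0 := fun h ↦ ha0 (by simp [h])
  have h2 : (2 : F) ≠ 0 := two_ne_zero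
  refine (Subgroup.eq_top_iff' _).2 fun t ↦ ⟨(1 + t) / 2, (t - 1) / (2 * c), ?_⟩
  field_simp
  ring

/-- **Local norms and the Hilbert symbol** (O'Meara §65A: "`α ∈ F_𝔭ˣ` is a local norm at
`𝔭` iff `(α, θ)_𝔭 = 1`"; from 63:10 / 57:9): for `a ≠ 0` in a field with `2 ≠ 0` and a unit `t`,
`(t, a)_F = 1` iff `t ∈ quadraticNormSubgroup F a`, i.e. iff `X² - a Y² = t` is soluble. Here
from `exists_sq_sub_mul_sq_iff_hilbertSymbol_eq_one` and the symmetry of the symbol.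
[cite: Omeara1963, §65A (before Example 65:1)] -/
theorem hilbertSymbol_eq_one_iff_mem_quadraticNormSubgroup [NeZero (2 : F)] {a : F} (ha : a ≠ 0)
    (t : Fˣ) : hilbertSymbol F t a = 1 ↔ t ∈ quadraticNormSubgroup F a := by
  rw [hilbertSymbol_comm, ← exists_sq_sub_mul_sq_iff_hilbertSymbol_eq_one ha t.ne_zero]
  rfl

/-- `(t, a)_F = -1` iff `t` is not a norm from `F[√a]` (`a ≠ 0`, `2 ≠ 0`). [folklore] -/
theorem hilbertSymbol_eq_neg_one_iff_not_mem_quadraticNormSubgroup [NeZero (2 : F)] {a : F}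
    (ha : a ≠ 0) (t : Fˣ) : hilbertSymbol F t a = -1 ↔ t ∉ quadraticNormSubgroup F a := by
  rw [← hilbertSymbol_ne_one_iff, Ne, hilbertSymbol_eq_one_iff_mem_quadraticNormSubgroup ha]

end Local

/-! ### Components of adèles and idèles; norm idèles -/

section Idele

variable (K : Type) [Field K] [NumberField K]

/-- The component `x ↦ x_w ∈ K_w` of an adèle at the infinite place `w`, a ring homomorphism
(`𝔸_K = K_∞ × 𝔸_K^f`, first factor `K_∞ = Π_w K_w`, evaluated at `w`); the archimedean twin
of the tree's finite-place projection `AdelicGroupData.adeleEval K v`. [folklore] -/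
def adeleInfiniteComponent (w : InfinitePlace K) : AdeleRing (𝓞 K) K →+* w.Completion where
  toFun x := x.1 w
  map_one' := rfl
  map_mul' _ _ := rfl
  map_zero' := rfl
  map_add' _ _ := rfl

/-- `adeleInfiniteComponent K w x = x_w` (definitional). [folklore] -/
@[simp]
theorem adeleInfiniteComponent_apply (w : InfinitePlace K) (x : AdeleRing (𝓞 K) K) :
    adeleInfiniteComponent K w x = x.1 w := rfl

/-- The component `i ↦ i_v ∈ K_vˣ` of an idèle at the finite place `v`: `Units.map` of the
projection `AdelicGroupData.adeleEval K v : 𝔸_K →+* K_v` (`AdelicGroupData.lean`); this is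
definitionally `(AdelicGroupData.gl1 K).toLocal v` (`ideleFiniteComponent_eq_toLocal`).
[folklore] -/
def ideleFiniteComponent (v : HeightOneSpectrum (𝓞 K)) : GaloisRepresentations.ideleGroup K →* (v.adicCompletion K)ˣ :=
  Units.map (Automorphic.AdelicGroupData.adeleEval K v).toMonoidHom

/-- `ideleFiniteComponent K v` is the local projection `toLocal v` of the adelic group datum
`GL₁ = AdelicGroupData.gl1 K` (definitional). [folklore] -/
theorem ideleFiniteComponent_eq_toLocal (v : HeightOneSpectrum (𝓞 K)) :
    ideleFiniteComponent K v = (Automorphic.AdelicGroupData.gl1 K).toLocal v := rfl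

/-- The component `i ↦ i_w ∈ K_wˣ` of an idèle at the infinite place `w` (`Units.map` of
`adeleInfiniteComponent`). [folklore] -/
def ideleInfiniteComponent (w : InfinitePlace K) : GaloisRepresentations.ideleGroup K →* (w.Completion)ˣ :=
  Units.map (adeleInfiniteComponent K w).toMonoidHom

/-- `(ideleFiniteComponent K v i : K_v) = i_v` (definitional): the `𝔭`-coordinate `𝔦_𝔭` of an idèle
`𝔦` (O'Meara §33D, "we let `𝔦_𝔭` denote the `𝔭`-coordinate of any `𝔦`"). [cite: Omeara1963, §33D (the idèle group `J_F`, coordinates `𝔦_𝔭`)] -/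
@[simp]
theorem val_ideleFiniteComponent (v : HeightOneSpectrum (𝓞 K)) (i : GaloisRepresentations.ideleGroup K) :
    (ideleFiniteComponent K v i : v.adicCompletion K) = (i : AdeleRing (𝓞 K) K).2 v := rfl

/-- `(ideleInfiniteComponent K w i : K_w) = i_w` (definitional): the coordinate of an idèle at an
archimedean spot (O'Meara §33D). [cite: Omeara1963, §33D (the idèle group `J_F`, coordinates `𝔦_𝔭`)] -/
@[simp]
theorem val_ideleInfiniteComponent (w : InfinitePlace K) (i : GaloisRepresentations.ideleGroup K) :
    (ideleInfiniteComponent K w i : w.Completion) = (i : AdeleRing (𝓞 K) K).1 w := rfl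

/-- The `v`-component of the principal idèle of `θ ∈ Kˣ` is `θ ∈ K_vˣ`. [folklore] -/
@[simp]
theorem ideleFiniteComponent_principal (v : HeightOneSpectrum (𝓞 K)) (θ : Kˣ) :
    ideleFiniteComponent K v (Units.map (algebraMap K (AdeleRing (𝓞 K) K) : K →* _) θ) =
      Units.map (algebraMap K (v.adicCompletion K) : K →* _) θ :=
  Units.ext rfl

/-- The `w`-component of the principal idèle of `θ ∈ Kˣ` is `θ ∈ K_wˣ`. [folklore] -/
@[simp]
theorem ideleInfiniteComponent_principal (w : InfinitePlace K) (θ : Kˣ) :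
    ideleInfiniteComponent K w (Units.map (algebraMap K (AdeleRing (𝓞 K) K) : K →* _) θ) =
      Units.map (algebraMap K w.Completion : K →* _) θ :=
  Units.ext rfl

/-- The **norm idèles** of `K(√a)/K`: the subgroup of idèles `i ∈ 𝕀_K` such that `i_v` is a norm
from `K_v[√a]` for every finite place `v` and `i_w` is a norm from `K_w[√a]` for every infinite
place `w` (`quadraticNormSubgroup`). For `a` a non-square in `K` and `E = K(√a)` this is the norm
group `N_{E/K} J_E ⊆ J_K` of the idèles of `E`: O'Meara §65A, Example 65:2 ("`i` is in
`N_{E/F} J_E` if and only if it is a local norm at all `𝔭`"; at the places split in `E`, where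
`a` is a local square, every element is a local norm). [cite: Omeara1963, §65A Example 65:2] -/
def normIdeles (a : K) : Subgroup (GaloisRepresentations.ideleGroup K) :=
  (⨅ v : HeightOneSpectrum (𝓞 K),
      (quadraticNormSubgroup (v.adicCompletion K) (algebraMap K _ a)).comap
        (ideleFiniteComponent K v)) ⊓
    ⨅ w : InfinitePlace K,
      (quadraticNormSubgroup w.Completion (algebraMap K _ a)).comap (ideleInfiniteComponent K w)

variable {K} in
/-- Membership in `normIdeles K a`: every component is a local norm — the defining sentence of
`N_{E/F} J_E` in Example 65:2 ("`𝔦` is in `N_{E/F} J_E` if and only if it is a local norm at all `𝔭`").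
[cite: Omeara1963, §65A Example 65:2] -/
theorem mem_normIdeles_iff {a : K} {i : GaloisRepresentations.ideleGroup K} :
    i ∈ normIdeles K a ↔
      (∀ v : HeightOneSpectrum (𝓞 K), ideleFiniteComponent K v i ∈
          quadraticNormSubgroup (v.adicCompletion K) (algebraMap K _ a)) ∧
        ∀ w : InfinitePlace K, ideleInfiniteComponent K w i ∈
          quadraticNormSubgroup w.Completion (algebraMap K _ a) := by
  simp only [normIdeles, Subgroup.mem_inf, Subgroup.mem_iInf, Subgroup.mem_comap]

/-- If `a = c²` is a non-zero square in `K` (so that `K(√a) = K`), every idèle is a norm idèle: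
`normIdeles K a = ⊤` (all local norm groups are everything,
`quadraticNormSubgroup_eq_top_of_isSquare`). [folklore] -/
theorem normIdeles_eq_top_of_isSquare {a : K} (ha : IsSquare a) (ha0 : a ≠ 0) :
    normIdeles K a = ⊤ := by
  refine (Subgroup.eq_top_iff' _).2 fun i ↦ mem_normIdeles_iff.2 ⟨fun v ↦ ?_, fun w ↦ ?_⟩
  · haveI : CharZero (v.adicCompletion K) :=
      charZero_of_injective_algebraMap (algebraMap K _).injective
    rw [quadraticNormSubgroup_eq_top_of_isSquare (ha.map _) ((map_ne_zero _).2 ha0)]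
    exact Subgroup.mem_top _
  · haveI : CharZero w.Completion := charZero_of_injective_algebraMap (algebraMap K _).injective
    rw [quadraticNormSubgroup_eq_top_of_isSquare (ha.map _) ((map_ne_zero _).2 ha0)]
    exact Subgroup.mem_top _

/-- A global norm `θ = x² - a y² ∈ Kˣ` from `K(√a)` gives a principal idèle that is a norm idèle.
[folklore] -/
theorem principal_mem_normIdeles {a : K} (θ : Kˣ) (h : ∃ x y : K, x ^ 2 - a * y ^ 2 = θ) :
    Units.map (algebraMap K (AdeleRing (𝓞 K) K) : K →* _) θ ∈ normIdeles K a := by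
  obtain ⟨x, y, hxy⟩ := h
  refine mem_normIdeles_iff.2 ⟨fun v ↦ ?_, fun w ↦ ?_⟩
  · rw [ideleFiniteComponent_principal]
    refine ⟨algebraMap K _ x, algebraMap K _ y, ?_⟩
    rw [Units.coe_map, MonoidHom.coe_coe, ← hxy, map_sub, map_pow, map_mul, map_pow]
  · rw [ideleInfiniteComponent_principal]
    refine ⟨algebraMap K _ x, algebraMap K _ y, ?_⟩
    rw [Units.coe_map, MonoidHom.coe_coe, ← hxy, map_sub, map_pow, map_mul, map_pow]

/-! ### Named facts: the global and the local norm index theorems -/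

/-- **Norm index of a quadratic extension** (O'Meara, Prop. 65:21; Vignéras, LNM 800, III
Thm. 3.7): let `E/K` be a quadratic extension of global fields; then `(J_K : P_K N_{E/K} J_E) = 2`
— the principal idèles times the norms of idèles of `E` form a subgroup of index `2` of the idèle
group of `K`. Here for a number field `K` and `E = K(√a)`, `a ∈ K` a non-square, with
`N_{E/K} J_E = normIdeles K a` (O'Meara Example 65:2) and `P_K = principalIdeles K`. The
fundamental equality of class field theory in the quadratic case; O'Meara's proof (§65B–§65D)
rests on the `S`-unit theorem and the finiteness of the class number (index computations
65:8–65:14: the inequality `2 ≤ (J_F : P_F N_{E/F} J_E)` and the Global Square Theorem 65:15),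
the local norm index 63:13a, and the independence of `S`-units modulo squares (65:17–65:18),
unavailable for number fields in Mathlib at the pin.
[cite: Omeara1963, §65D Prop. 65:21] -/
def normIdeles_index_eq_two : Prop :=
  ∀ a : K, ¬ IsSquare a → ((GaloisRepresentations.principalIdeles K) ⊔ normIdeles K a).index = 2

/-- **The second inequality for a quadratic extension** (O'Meara, proof of Prop. 65:21,
step 1: *"In virtue of Proposition 65:14 it is enough to prove that
`(J_F : P_F N_{E/F} J_E) ≤ 2`"* — and steps 1)–2) prove exactly this inequality, from the idèle
index `(J_F : P_F J_F^{S,2}) = 2^s` (65:12), the places `𝔭_1, …, 𝔭_s` attached to generators of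
the `S`-units modulo squares (65:18) and Cor. 65:18a). In class field theory this is the
*second fundamental inequality* `(J_K : P_K N_{E/K} J_E) ≤ [E : K]` in the quadratic (Kummer)
case, here for the number field `K` and `E = K(√a)`, `a` a non-square, with
`N_{E/K} J_E = normIdeles K a` (Example 65:2): the subgroup `principalIdeles K ⊔ normIdeles K a`
of `𝕀_K` has index dividing `2` (Mathlib's `Subgroup.index` is a natural number, `0` for
infinite index, so `index ∣ 2` says: finite index, equal to `1` or `2`). Weaker than
`normIdeles_index_eq_two` (`normIdeles_index_dvd_two_of_eq_two`); the reverse inequality `≥ 2`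
(65:14) is where O'Meara uses the unit index 65:10, and in the applications in this directory
(`HilbertSymbolPrescribedProofs.lean`) it is supplied instead by Hilbert's reciprocity law 71:18.
[cite: Omeara1963, §65D Prop. 65:21 (proof, step 1)] -/
def normIdeles_index_dvd_two : Prop :=
  ∀ a : K, ¬ IsSquare a → ((GaloisRepresentations.principalIdeles K) ⊔ normIdeles K a).index ∣ 2

variable {K} in
/-- `65:21 ⇒` the second inequality: index `2` divides `2`. [folklore] -/
theorem normIdeles_index_dvd_two_of_eq_two (h : normIdeles_index_eq_two K) :
    normIdeles_index_dvd_two K := fun a ha ↦ by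
  rw [h a ha]

variable {K} in
/-- Under the second inequality, `principalIdeles K ⊔ normIdeles K a` (for `a` a non-square) is
either everything or a subgroup of index `2` (an index dividing `2` is `1` or `2`; the dichotomy of
O'Meara's proof of 65:21, step 1). [cite: Omeara1963, §65D Prop. 65:21 (proof, step 1)] -/
theorem index_eq_one_or_eq_two_of_normIdeles_index_dvd_two (h : normIdeles_index_dvd_two K)
    {a : K} (ha : ¬ IsSquare a) :
    ((GaloisRepresentations.principalIdeles K) ⊔ normIdeles K a).index = 1 ∨
      ((GaloisRepresentations.principalIdeles K) ⊔ normIdeles K a).index = 2 := by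
  have h2 : Nat.Prime 2 := Nat.prime_two
  exact (Nat.dvd_prime h2).1 (h a ha)

/-- **The first inequality for a quadratic extension** (O'Meara, Prop. 65:14:
*"`2 ≤ (J_F : P_F N_{E/F} J_E) < ∞`"*, proved from the unit index 65:10 — Herbrand's lemma 65:9
applied to the `S`-units of `E = F(√θ)` — via 65:8 and 65:13). Here for the number field `K` and
`E = K(√a)`, `a` a non-square, with `N_{E/K} J_E = normIdeles K a` (Example 65:2): the subgroup
`principalIdeles K ⊔ normIdeles K a` of `𝕀_K` has index at least `2` — with Mathlib's
`Subgroup.index` (a natural number, `0` for infinite index) `2 ≤ index` encodes both printed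
assertions, `2 ≤` and `< ∞`. Together with the second inequality `normIdeles_index_dvd_two` it
gives 65:21 back (`normIdeles_index_eq_two_of_dvd_two_of_two_le`); its consequence
`J_K ≠ P_K N_{E/K} J_E` (`ne_top_of_two_le_normIdeles_index`) is the form in which 65:14 is used in
the proofs of the Global Square Theorem 65:15 and of Cor. 65:18a. In the tree, Herbrand's lemma
65:9 is `Literature/GroupTheory/Index/HerbrandLemma.lean` and the `S`-unit theorem 33:10 is
`Literature/NumberTheory/DiophantineGeometry/SUnitTheorem.lean`; the unit index 65:10 itself
(units of `E`, their norms and the places of `E` above those of `F`) is not formalized.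
[cite: Omeara1963, §65B Prop. 65:14] -/
def two_le_normIdeles_index : Prop :=
  ∀ a : K, ¬ IsSquare a → 2 ≤ ((GaloisRepresentations.principalIdeles K) ⊔ normIdeles K a).index

variable {K} in
/-- **65:14 ⇒ `J_K ≠ P_K · N_{E/K} J_E`**: a subgroup of index `≥ 2` is proper (the form in which
the first inequality is used in the proofs of 65:15 and 65:18a: "this conclusion is absurd since
`(J_F : P_F N_{E/F} J_E) ≥ 2`"). [cite: Omeara1963, §65B Prop. 65:14] -/
theorem ne_top_of_two_le_normIdeles_index (h : two_le_normIdeles_index K) {a : K}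
    (ha : ¬ IsSquare a) : (GaloisRepresentations.principalIdeles K) ⊔ normIdeles K a ≠ ⊤ := fun htop ↦ by
  have h2 := h a ha
  rw [htop, Subgroup.index_top] at h2
  exact absurd h2 (by norm_num)

variable {K} in
/-- `65:21 ⇒ 65:14`: index `2` is at least `2`. [folklore] -/
theorem two_le_normIdeles_index_of_eq_two (h : normIdeles_index_eq_two K) :
    two_le_normIdeles_index K := fun a ha ↦ by
  rw [h a ha]

variable {K} in
/-- **65:21 = first inequality + second inequality**: an index dividing `2` and at least `2` is
`2`. [cite: Omeara1963, §65D Prop. 65:21 (proof, step 1)] -/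
theorem normIdeles_index_eq_two_of_dvd_two_of_two_le (h2 : normIdeles_index_dvd_two K)
    (h1 : two_le_normIdeles_index K) : normIdeles_index_eq_two K := fun a ha ↦ by
  rcases index_eq_one_or_eq_two_of_normIdeles_index_dvd_two h2 ha with h | h
  · have := h1 a ha
    rw [h] at this
    exact absurd this (by norm_num)
  · exact h

/-- **Surjectivity of the local Hilbert symbol** (O'Meara, Prop. 63:13): let `F` be a local
field (or a complete archimedean field); given any non-square `β ∈ Fˣ` there is `α ∈ Fˣ` with
Hilbert symbol `(α, β)_F = -1`. Vendored for the completions `F = K_v` of the number field `K`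
at its finite places `v` (the case used in the proof of 71:19; for `F` real one takes `α = -1`,
and the complex case cannot arise). Equivalently: the norm group of the quadratic extension
`F(√β)/F` is a proper subgroup of `Fˣ` (with 63:13a, of index exactly `2`). O'Meara's proof
uses the quadratic defect and, at dyadic places, units of defect `4𝔬` (§63A).
[cite: Omeara1963, §63B Prop. 63:13] -/
def adicCompletion_exists_hilbertSymbol_eq_neg_one : Prop :=
  ∀ (v : HeightOneSpectrum (𝓞 K)) (β : v.adicCompletion K), β ≠ 0 → ¬ IsSquare β →
    ∃ α : v.adicCompletion K, α ≠ 0 ∧ hilbertSymbol (v.adicCompletion K) α β = -1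

end Idele

end Literature.NumberTheory.QuadraticForms
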